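import Literature.Topology.FourManifolds.HomotopySpheres
import Literature.Topology.FourManifolds.EquidimensionalEmbedding
import Literature.AlgebraicTopology.FundamentalGroup.SphereSimplyConnected
import Mathlib.Topology.Covering.Basic
import Mathlib.Topology.Homotopy.Lifting

/-!
# Round creases of immersed fake balls are embedded round spheres

Helper file (1/2) for the support item `RoundCreaseStandard` of route EuclideanOrigami
(stmt-SmoothPoincare4-10644), whose statement is shared VERBATIM with the registered stub
`stub_roundCreaseStandard` of line `round-trace-continuity` (crux `OrigamiFoldExistence`,
stmt-SmoothPoincare4-7844, route SymplecticOrigami); everything here is proved, no definitions,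
no named facts.

Setting (the hypothesis pattern of route EuclideanOrigami): `S` a homotopy 4-sphere,
`e : ℝ⁴ → S` a smooth embedding (chart ball), `F : S → ℝ⁴` a local diffeomorphism at every point
outside `e(B̊⁴)` (an IMMERSED FAKE BALL), whose CREASE `F ∘ e|S³` lies in a round sphere:
`dist (F (e u)) c = r` for `‖u‖ = 1`. We prove:

* `radius_pos`: `0 < r` — a local diffeomorphism is not constant on the unit sphere, which has no
  isolated point (it is connected with at least two points);
* `injOn_comp_sphere`: **`F ∘ e` is injective on the unit sphere and maps it onto `S_r(c)`**. The
  normalised crease `u ↦ r⁻¹ • (F (e u) - c)` is a smooth self-map of `S³` whose differential is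
  injective (chain rule through the inclusion `S³ ↪ ℝ⁴`, Mathlib `mfderiv_coe_sphere_injective`),
  hence a local diffeomorphism (inverse function theorem on manifolds, tree
  `isLocalDiffeomorphAt_of_mfderiv`), hence a covering map of the compact `S³` (Mathlib
  `isLocalHomeomorph_iff_isCoveringMap`), hence injective because `S³` is simply connected (tree
  `simplyConnectedSpace_euclideanSphere`; lifting criterion, Hatcher Props. 1.33–1.34) and
  surjective (open and closed image);
* bookkeeping on the fake ball `Δ_e = (e(B̊⁴))ᶜ`, its interior `(e(B̄⁴))ᶜ` and its boundary
  `e(S³)` (`isOpen_image_ball`, `mem_compl_image_ball`, …), and two general lemmas: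
  `injective_of_isCoveringMap` (a covering of a simply connected space by a connected space is
  injective) and `isLocalHomeomorph_restrict`.

The companion file `EuclideanOrigamiRoundCreaseStandardSheets.lean` counts the sheets of `F` over
the round ball; the stub file `SymplecticOrigamiOrigamiFoldExistenceStubRoundCreaseStandard.lean`
assembles the twisted sphere.

References: A. Hatcher, *Algebraic Topology* (2002), Props. 1.33–1.34 [HatcherAT2002]; J. M. Lee,
*Introduction to Smooth Manifolds*, 2nd ed. (2013), Thm. 4.5 [LeeSmoothManifolds2013];
M. W. Hirsch, *Differential Topology* (1976), Ch. 1 §3, Ch. 2 §1 [HirschDT1976].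
-/

noncomputable section

-- the prescribed namespace `Summit.<P>.<Sub>.…` duplicates `SmoothPoincare4` (P = Sub)
set_option linter.dupNamespace false

open scoped Manifold ContDiff Topology
open Set Function Metric
open Literature.Topology.FourManifolds (HomotopySphere)

namespace Summit.SmoothPoincare4.SmoothPoincare4.Theorems.EuclideanOrigami.RoundCreaseStandard

/-! ### Two general lemmas -/

/-- **A covering map from a nonempty connected space onto a simply connected, locally path
connected space is injective** (lift the identity to a section and use uniqueness of lifts;
Hatcher, *Algebraic Topology*, Props. 1.33–1.34). -/
theorem injective_of_isCoveringMap {X Y : Type*} [TopologicalSpace X] [TopologicalSpace Y]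
    [PreconnectedSpace X] [Nonempty X] [SimplyConnectedSpace Y] [LocallyPathConnectedSpace Y]
    {p : X → Y} (hp : IsCoveringMap p) : Injective p := by
  obtain ⟨x₀⟩ := ‹Nonempty X›
  obtain ⟨s, ⟨hs₀, hs⟩, -⟩ :=
    hp.existsUnique_continuousMap_lifts (ContinuousMap.id Y) (p x₀) x₀ rfl
  have hps : ∀ y, p (s y) = y := fun y => congrFun hs y
  have hsp : (⇑s ∘ p) = id :=
    hp.eq_of_comp_eq (s.continuous.comp hp.continuous) continuous_id
      (funext fun x => by simp [hps]) x₀ (by simpa using hs₀)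
  exact LeftInverse.injective (g := s) fun x => congrFun hsp x

/-- The restriction to an open set `U` of a map which is a local homeomorphism at every point of
`U` is a local homeomorphism `U → Y`. -/
theorem isLocalHomeomorph_restrict {X Y : Type*} [TopologicalSpace X] [TopologicalSpace Y]
    {f : X → Y} {U : Set X} (hU : IsOpen U) (hf : IsLocalHomeomorphOn f U) :
    IsLocalHomeomorph (U.restrict f) := by
  intro x
  obtain ⟨e, hxe, hfe⟩ := hf x.1 x.2
  refine ⟨e.subtypeRestr (s := ⟨U, hU⟩) ⟨x⟩, ?_, ?_⟩
  · rw [OpenPartialHomeomorph.subtypeRestr_source]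
    exact hxe
  · rw [OpenPartialHomeomorph.subtypeRestr_coe, hfe]
    rfl

/-! ### The crease -/

variable (S : HomotopySphere 4) {e : (EuclideanSpace ℝ (Fin 4)) → S.carrier} {F : S.carrier → (EuclideanSpace ℝ (Fin 4))}

/-- `F ∘ e` is a local diffeomorphism of `ℝ⁴` at every point `u` with `1 ≤ ‖u‖`: `e` is an
equidimensional smooth embedding, hence a local diffeomorphism, and `e u ∉ e(B̊⁴)`. -/
theorem isLocalDiffeomorphAt_comp (hE : Manifold.IsSmoothEmbedding (𝓡 4) (𝓡 4) ∞ e)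
    (hF : ∀ x, x ∉ e '' ball (0 : (EuclideanSpace ℝ (Fin 4))) 1 → IsLocalDiffeomorphAt (𝓡 4) (𝓡 4) ∞ F x)
    {u : (EuclideanSpace ℝ (Fin 4))} (hu : 1 ≤ ‖u‖) : IsLocalDiffeomorphAt (𝓡 4) (𝓡 4) ∞ (F ∘ e) u := by
  refine (hE.isLocalDiffeomorph_of_finrank_eq rfl u).comp (K := 𝓡 4) (P := (EuclideanSpace ℝ (Fin 4))) (hF _ ?_)
  rintro ⟨v, hv, hve⟩
  rw [hE.isEmbedding.injective hve, mem_ball_zero_iff] at hv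
  exact not_lt.2 hu hv

/-- `1 < dim ℝ⁴` (as a cardinal), the hypothesis of Mathlib's connectivity lemmas for spheres. -/
theorem one_lt_rank_four : 1 < Module.rank ℝ (EuclideanSpace ℝ (Fin 4)) := by
  rw [← Module.finrank_eq_rank, finrank_euclideanSpace_fin]
  norm_num

/-- **The radius of a round crease is positive.** If `dist (F (e u)) c = r` on the unit sphere
then `0 < r`: otherwise `F ∘ e` is constant on the unit sphere, but it is injective near the unit
vector `u₀` (local diffeomorphism) and the connected sphere has another point near `u₀`. -/
theorem radius_pos (hE : Manifold.IsSmoothEmbedding (𝓡 4) (𝓡 4) ∞ e)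
    (hF : ∀ x, x ∉ e '' ball (0 : (EuclideanSpace ℝ (Fin 4))) 1 → IsLocalDiffeomorphAt (𝓡 4) (𝓡 4) ∞ F x)
    {c : (EuclideanSpace ℝ (Fin 4))} {r : ℝ} (hround : ∀ u : (EuclideanSpace ℝ (Fin 4)), ‖u‖ = 1 → dist (F (e u)) c = r) : 0 < r := by
  set u₀ : (EuclideanSpace ℝ (Fin 4)) := EuclideanSpace.single 0 1 with hu₀def
  have hu₀ : ‖u₀‖ = 1 := by simp [hu₀def]
  have hr0 : 0 ≤ r := hround u₀ hu₀ ▸ dist_nonneg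
  rcases hr0.eq_or_lt with h | h
  swap
  · exact h
  exfalso
  have hc : ∀ u : (EuclideanSpace ℝ (Fin 4)), ‖u‖ = 1 → F (e u) = c := fun u hu =>
    dist_eq_zero.1 ((hround u hu).trans h.symm)
  obtain ⟨Φ, hu₀Φ, heq⟩ := isLocalDiffeomorphAt_comp S hE hF hu₀.ge
  have hpre : IsPreconnected (sphere (0 : (EuclideanSpace ℝ (Fin 4))) 1) := isPreconnected_sphere one_lt_rank_four 0 1
  have hneg : -u₀ ≠ u₀ := by
    intro h'
    have := congrArg (fun v : (EuclideanSpace ℝ (Fin 4)) => v 0) h'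
    simp [hu₀def] at this
    norm_num at this
  obtain ⟨u₁, hu₁s, hu₁Φ, hu₁ne⟩ := hpre Φ.source {u₀}ᶜ Φ.open_source isOpen_compl_singleton
      (fun v _ => by
        by_cases hvu : v = u₀
        · exact Or.inl (hvu ▸ hu₀Φ)
        · exact Or.inr hvu)
      ⟨u₀, by simp [hu₀], hu₀Φ⟩ ⟨-u₀, by simp [hu₀], hneg⟩
  have h1 : Φ u₁ = Φ u₀ := by
    rw [← heq hu₁Φ, ← heq hu₀Φ]
    show F (e u₁) = F (e u₀)
    rw [hc u₁ (by simpa using hu₁s), hc u₀ hu₀]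
  exact hu₁ne (Φ.injOn hu₁Φ hu₀Φ h1)

/-- **A round crease is an embedded round sphere.** If `dist (F (e u)) c = r` on the unit
sphere, then `F ∘ e` is injective on the unit sphere and maps it onto `sphere c r`: the normalised
crease is a local diffeomorphism `S³ → S³` (injective differential + inverse function theorem),
hence a covering map of the compact `S³`, hence a bijection since `S³` is simply connected and
connected. -/
theorem injOn_comp_sphere (hE : Manifold.IsSmoothEmbedding (𝓡 4) (𝓡 4) ∞ e)
    (hF : ∀ x, x ∉ e '' ball (0 : (EuclideanSpace ℝ (Fin 4))) 1 → IsLocalDiffeomorphAt (𝓡 4) (𝓡 4) ∞ F x)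
    {c : (EuclideanSpace ℝ (Fin 4))} {r : ℝ} (hround : ∀ u : (EuclideanSpace ℝ (Fin 4)), ‖u‖ = 1 → dist (F (e u)) c = r) :
    InjOn (F ∘ e) (sphere (0 : (EuclideanSpace ℝ (Fin 4))) 1) ∧ (F ∘ e) '' sphere (0 : (EuclideanSpace ℝ (Fin 4))) 1 = sphere c r := by
  have hr := radius_pos S hE hF hround
  haveI hfact : Fact (Module.finrank ℝ (EuclideanSpace ℝ (Fin 4)) = 3 + 1) := ⟨by simp⟩
  -- the affine normalisation `A y = r⁻¹ • (y - c)` as a diffeomorphism of `ℝ⁴`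
  let A : (EuclideanSpace ℝ (Fin 4)) ≃ₘ⟮𝓡 4, 𝓡 4⟯ (EuclideanSpace ℝ (Fin 4)) :=
    { toFun := fun y => r⁻¹ • (y - c)
      invFun := fun z => r • z + c
      left_inv := fun y => by simp [smul_smul, hr.ne']
      right_inv := fun z => by simp [smul_smul, hr.ne']
      contMDiff_toFun := ((contDiff_id.sub contDiff_const).const_smul r⁻¹).contMDiff
      contMDiff_invFun := ((contDiff_id.const_smul r).add contDiff_const).contMDiff }
  set G : (EuclideanSpace ℝ (Fin 4)) → (EuclideanSpace ℝ (Fin 4)) := fun y => r⁻¹ • (F (e y) - c) with hGdef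
  have hGA : G = A ∘ (F ∘ e) := rfl
  have hGloc : ∀ u : (EuclideanSpace ℝ (Fin 4)), 1 ≤ ‖u‖ → IsLocalDiffeomorphAt (𝓡 4) (𝓡 4) ∞ G u := fun u hu => by
    rw [hGA]
    exact (isLocalDiffeomorphAt_comp S hE hF hu).comp (K := 𝓡 4) (P := (EuclideanSpace ℝ (Fin 4))) (A.isLocalDiffeomorph _)
  have hGmem : ∀ u : (Metric.sphere (0 : EuclideanSpace ℝ (Fin 4)) 1), G u ∈ sphere (0 : (EuclideanSpace ℝ (Fin 4))) 1 := fun u => by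
    have h1 : dist (F (e u)) c = r := hround u (norm_eq_of_mem_sphere u)
    rw [mem_sphere_zero_iff_norm, hGdef]
    dsimp only
    rw [norm_smul, norm_inv, Real.norm_of_nonneg hr.le, ← dist_eq_norm, h1, inv_mul_cancel₀ hr.ne']
  set f : (Metric.sphere (0 : EuclideanSpace ℝ (Fin 4)) 1) → (Metric.sphere (0 : EuclideanSpace ℝ (Fin 4)) 1) := Set.codRestrict (fun u : (Metric.sphere (0 : EuclideanSpace ℝ (Fin 4)) 1) => G u) (sphere (0 : (EuclideanSpace ℝ (Fin 4))) 1) hGmem with hfdef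
  have hu1 : ∀ u : (Metric.sphere (0 : EuclideanSpace ℝ (Fin 4)) 1), 1 ≤ ‖(u : (EuclideanSpace ℝ (Fin 4)))‖ := fun u => (norm_eq_of_mem_sphere u).ge
  -- smoothness of the normalised crease
  have hGsm : ContMDiff (𝓡 3) 𝓘(ℝ, (EuclideanSpace ℝ (Fin 4))) ∞ (fun u : (Metric.sphere (0 : EuclideanSpace ℝ (Fin 4)) 1) => G u) := fun u =>
    ((hGloc u (hu1 u)).contMDiffAt).comp u (contMDiff_coe_sphere u)
  have hfsm : ContMDiff (𝓡 3) (𝓡 3) ∞ f := hGsm.codRestrict_sphere hGmem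
  -- injectivity of its differential (chain rule through the inclusion of the sphere)
  have hfd : ∀ u : (Metric.sphere (0 : EuclideanSpace ℝ (Fin 4)) 1), Injective (mfderiv (𝓡 3) (𝓡 3) f u) := by
    intro u
    have hι := contMDiff_coe_sphere (E := (EuclideanSpace ℝ (Fin 4))) (n := 3) (m := ∞)
    have h1 : mfderiv (𝓡 3) 𝓘(ℝ, (EuclideanSpace ℝ (Fin 4))) ((Subtype.val : (Metric.sphere (0 : EuclideanSpace ℝ (Fin 4)) 1) → (EuclideanSpace ℝ (Fin 4))) ∘ f) u =
        (mfderiv (𝓡 3) 𝓘(ℝ, (EuclideanSpace ℝ (Fin 4))) (Subtype.val : (Metric.sphere (0 : EuclideanSpace ℝ (Fin 4)) 1) → (EuclideanSpace ℝ (Fin 4))) (f u)).comp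
          (mfderiv (𝓡 3) (𝓡 3) f u) :=
      mfderiv_comp u ((hι (f u)).mdifferentiableAt (by simp))
        ((hfsm u).mdifferentiableAt (by simp))
    have h2 : (Subtype.val : (Metric.sphere (0 : EuclideanSpace ℝ (Fin 4)) 1) → (EuclideanSpace ℝ (Fin 4))) ∘ f = G ∘ (Subtype.val : (Metric.sphere (0 : EuclideanSpace ℝ (Fin 4)) 1) → (EuclideanSpace ℝ (Fin 4))) := rfl
    have h3 : mfderiv (𝓡 3) 𝓘(ℝ, (EuclideanSpace ℝ (Fin 4))) (G ∘ (Subtype.val : (Metric.sphere (0 : EuclideanSpace ℝ (Fin 4)) 1) → (EuclideanSpace ℝ (Fin 4)))) u =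
        (mfderiv 𝓘(ℝ, (EuclideanSpace ℝ (Fin 4))) 𝓘(ℝ, (EuclideanSpace ℝ (Fin 4))) G (u : (EuclideanSpace ℝ (Fin 4)))).comp
          (mfderiv (𝓡 3) 𝓘(ℝ, (EuclideanSpace ℝ (Fin 4))) (Subtype.val : (Metric.sphere (0 : EuclideanSpace ℝ (Fin 4)) 1) → (EuclideanSpace ℝ (Fin 4))) u) :=
      mfderiv_comp u (((hGloc u (hu1 u)).contMDiffAt).mdifferentiableAt (by simp))
        ((hι u).mdifferentiableAt (by simp))
    have hinjG : Injective (mfderiv 𝓘(ℝ, (EuclideanSpace ℝ (Fin 4))) 𝓘(ℝ, (EuclideanSpace ℝ (Fin 4))) G (u : (EuclideanSpace ℝ (Fin 4)))) := fun a b hab =>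
      ((hGloc u (hu1 u)).mfderivToContinuousLinearEquiv (by simp)).injective hab
    have key : Injective (⇑(mfderiv (𝓡 3) 𝓘(ℝ, (EuclideanSpace ℝ (Fin 4))) (Subtype.val : (Metric.sphere (0 : EuclideanSpace ℝ (Fin 4)) 1) → (EuclideanSpace ℝ (Fin 4))) (f u)) ∘
        ⇑(mfderiv (𝓡 3) (𝓡 3) f u)) := by
      have h4 : ⇑(mfderiv (𝓡 3) 𝓘(ℝ, (EuclideanSpace ℝ (Fin 4))) (Subtype.val : (Metric.sphere (0 : EuclideanSpace ℝ (Fin 4)) 1) → (EuclideanSpace ℝ (Fin 4))) (f u)) ∘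
          ⇑(mfderiv (𝓡 3) (𝓡 3) f u) =
            ⇑(mfderiv (𝓡 3) 𝓘(ℝ, (EuclideanSpace ℝ (Fin 4))) (G ∘ (Subtype.val : (Metric.sphere (0 : EuclideanSpace ℝ (Fin 4)) 1) → (EuclideanSpace ℝ (Fin 4)))) u) := by
        rw [← h2, h1]
        rfl
      rw [h4, h3]
      exact hinjG.comp (mfderiv_coe_sphere_injective u)
    exact key.of_comp
  -- hence a local diffeomorphism (inverse function theorem on manifolds)
  have hfloc : IsLocalDiffeomorph (𝓡 3) (𝓡 3) ∞ f := fun u => by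
    set L₀ : (EuclideanSpace ℝ (Fin 3)) →L[ℝ] (EuclideanSpace ℝ (Fin 3)) := mfderiv (𝓡 3) (𝓡 3) f u with hL₀
    have hLinj : Injective L₀ := hfd u
    let L : (EuclideanSpace ℝ (Fin 3)) ≃L[ℝ] (EuclideanSpace ℝ (Fin 3)) := (LinearEquiv.ofBijective L₀.toLinearMap
        ⟨hLinj, LinearMap.surjective_of_injective hLinj⟩).toContinuousLinearEquiv
    refine Literature.Topology.FourManifolds.isLocalDiffeomorphAt_of_mfderiv isOpen_univ (mem_univ u)
      hfsm.contMDiffOn (by exact_mod_cast le_top) L ?_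
    ext v
    rfl
  -- a covering map of the simply connected `S³`, hence bijective
  haveI : PreconnectedSpace (Metric.sphere (0 : EuclideanSpace ℝ (Fin 4)) 1) :=
    Subtype.preconnectedSpace (isPreconnected_sphere one_lt_rank_four 0 1)
  haveI : Nonempty (Metric.sphere (0 : EuclideanSpace ℝ (Fin 4)) 1) := ⟨⟨EuclideanSpace.single 0 1, by simp⟩⟩
  haveI : SimplyConnectedSpace (Metric.sphere (0 : EuclideanSpace ℝ (Fin 4)) 1) :=
    Literature.AlgebraicTopology.FundamentalGroup.simplyConnectedSpace_euclideanSphere 3 (by norm_num)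
  haveI : LocallyPathConnectedSpace (Metric.sphere (0 : EuclideanSpace ℝ (Fin 4)) 1) := ChartedSpace.locallyPathConnectedSpace (EuclideanSpace ℝ (Fin 3)) (Metric.sphere (0 : EuclideanSpace ℝ (Fin 4)) 1)
  have hcov : IsCoveringMap f := isLocalHomeomorph_iff_isCoveringMap.1 hfloc.isLocalHomeomorph
  have hfinj : Injective f := injective_of_isCoveringMap hcov
  have hfsurj : Surjective f := hfloc.surjective_of_compactSpace
  refine ⟨fun u hu v hv huv => ?_, Subset.antisymm ?_ ?_⟩
  · have : f ⟨u, hu⟩ = f ⟨v, hv⟩ := by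
      apply Subtype.ext
      show G u = G v
      simp only [hGdef]
      rw [show F (e u) = F (e v) from huv]
    exact congrArg Subtype.val (hfinj this)
  · rintro _ ⟨u, hu, rfl⟩
    exact mem_sphere.2 (hround u (mem_sphere_zero_iff_norm.1 hu))
  · intro z hz
    have hw : r⁻¹ • (z - c) ∈ sphere (0 : (EuclideanSpace ℝ (Fin 4))) 1 := by
      rw [mem_sphere_zero_iff_norm, norm_smul, norm_inv, Real.norm_of_nonneg hr.le, ← dist_eq_norm,
        mem_sphere.1 hz, inv_mul_cancel₀ hr.ne']
    obtain ⟨u, hu⟩ := hfsurj ⟨_, hw⟩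
    refine ⟨u, u.2, ?_⟩
    have h1 : G u = r⁻¹ • (z - c) := congrArg Subtype.val hu
    have h2 : r • G u + c = r • (r⁻¹ • (z - c)) + c := by rw [h1]
    simpa [hGdef, smul_smul, hr.ne'] using h2

/-! ### The fake ball, its interior and its boundary sphere -/

/-- `e(B̊⁴)` is open in `S` (an equidimensional smooth embedding is an open map). -/
theorem isOpen_image_ball (hE : Manifold.IsSmoothEmbedding (𝓡 4) (𝓡 4) ∞ e) :
    IsOpen (e '' ball (0 : (EuclideanSpace ℝ (Fin 4))) 1) :=
  (hE.isLocalDiffeomorph_of_finrank_eq rfl).isOpenMap _ isOpen_ball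

/-- `e(B̄⁴)` is closed in `S` (compact image). -/
theorem isClosed_image_closedBall (hE : Manifold.IsSmoothEmbedding (𝓡 4) (𝓡 4) ∞ e) :
    IsClosed (e '' closedBall (0 : (EuclideanSpace ℝ (Fin 4))) 1) :=
  ((isCompact_closedBall (0 : (EuclideanSpace ℝ (Fin 4))) 1).image hE.contMDiff.continuous).isClosed

/-- A point of the fake ball `Δ_e = (e(B̊⁴))ᶜ` lies either off `e(B̄⁴)` or on the boundary sphere
`e(S³)`. -/
theorem mem_compl_image_ball {x : S.carrier} (hx : x ∈ (e '' ball (0 : (EuclideanSpace ℝ (Fin 4))) 1)ᶜ) :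
    x ∈ (e '' closedBall (0 : (EuclideanSpace ℝ (Fin 4))) 1)ᶜ ∨ ∃ u ∈ sphere (0 : (EuclideanSpace ℝ (Fin 4))) 1, e u = x := by
  by_cases h : x ∈ e '' closedBall (0 : (EuclideanSpace ℝ (Fin 4))) 1
  · obtain ⟨u, hu, rfl⟩ := h
    refine Or.inr ⟨u, ?_, rfl⟩
    have : ¬ ‖u‖ < 1 := fun h' => hx ⟨u, mem_ball_zero_iff.2 h', rfl⟩
    rw [mem_sphere_zero_iff_norm]
    exact le_antisymm (mem_closedBall_zero_iff.1 hu) (not_lt.1 this)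
  · exact Or.inl h

/-- `(e(B̄⁴))ᶜ ⊆ (e(B̊⁴))ᶜ`. -/
theorem compl_image_closedBall_subset :
    (e '' closedBall (0 : (EuclideanSpace ℝ (Fin 4))) 1)ᶜ ⊆ (e '' ball (0 : (EuclideanSpace ℝ (Fin 4))) 1)ᶜ :=
  compl_subset_compl.2 (image_mono ball_subset_closedBall)

/-- The boundary sphere `e(S³)` lies in the fake ball `(e(B̊⁴))ᶜ`. -/
theorem image_sphere_subset (hE : Manifold.IsSmoothEmbedding (𝓡 4) (𝓡 4) ∞ e) :
    e '' sphere (0 : (EuclideanSpace ℝ (Fin 4))) 1 ⊆ (e '' ball (0 : (EuclideanSpace ℝ (Fin 4))) 1)ᶜ := by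
  rintro _ ⟨u, hu, rfl⟩ ⟨v, hv, hve⟩
  rw [hE.isEmbedding.injective hve] at hv
  exact (mem_sphere_zero_iff_norm.1 hu).not_lt (mem_ball_zero_iff.1 hv)

/-- `F` is continuous on the fake ball (it is a local diffeomorphism there). -/
theorem continuousOn_compl_image_ball
    (hF : ∀ x, x ∉ e '' ball (0 : (EuclideanSpace ℝ (Fin 4))) 1 → IsLocalDiffeomorphAt (𝓡 4) (𝓡 4) ∞ F x) :
    ContinuousOn F (e '' ball (0 : (EuclideanSpace ℝ (Fin 4))) 1)ᶜ := fun x hx =>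
  (hF x hx).contMDiffAt.continuousAt.continuousWithinAt

end Summit.SmoothPoincare4.SmoothPoincare4.Theorems.EuclideanOrigami.RoundCreaseStandard

end
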